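import Summits.QuantumFields.BalabanUV.T4Continuum.Support.NE7InvariantFunctionalLetter
import Summits.QuantumFields.BalabanUV.T4Continuum.Support.NE7ExactCurrent
import Summits.QuantumFields.BalabanUV.T4Continuum.Support.NE7CombSliceSourceDuality
import Summits.QuantumFields.BalabanUV.T4Continuum.Support.NE3CpushGaugeCovariance
import Summits.QuantumFields.BalabanUV.T4Continuum.Support.NE3FrameFreeDecompositionLinear
import Summits.QuantumFields.BalabanUV.T4Continuum.Support.NE3FrameFreeDecompositionPrep
import Summits.QuantumFields.BalabanUV.T4Continuum.Support.NE3LandauOrbit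
import Summits.QuantumFields.BalabanUV.T4Continuum.Support.NE3EnergyAssembly
import Summits.QuantumFields.BalabanUV.T4Continuum.Support.AveragingDeficitTorusChart
import HarnessLib

/-!
# NE7SymmetricCriticality — PALAIS' PRINCIPLE OF SYMMETRIC CRITICALITY FOR THE CONSTRAINED WILSON ACTION ON THE LATTICE: a configuration `U` FIXED by a
# set `𝒦` of unitary periodic gauge transformations, which is tangent-critical along the `𝒦`-INVARIANT tangent directions only, is tangent-critical along
# EVERY tangent direction

Cell `pub-balaban`, rung (B)+1 sub-cell t4, lineage `b2b-balaban-t4-ne7b-p1` (row NE7b OWNER + CRUX PROVER; junction service for row NE7, ruling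
R-OWNER-149-1 (2)), generation 158.  Junction census of ROAD-G114 §8's STABILISER DESIGN ISSUE (the genericity hypothesis of
`NE7MinimalActionDifferentiable.minAct_hasFDerivAt_generic`; «whenever Stab(V₀) moves U♯ …»).  File 2 of the census (file 1: `NE7InvariantFunctionalLetter`).

THE ARGUMENT.  `U` unitary in the multi-level small-field class (so that the `(k+1)`-fold linearised average `D_U = dirIter L (k+1) U` is linear and
gauge-covariant: `NE3TangentCovariantTower.dirIter_add`, `NE7CombSliceSourceDuality.dirIter_smul`, `NE3CpushGaugeCovariance.dirIter_gaugeAct`), `𝒦` a set of unitary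
`P`-periodic site fields `g` with `gaugeAct g U = U`.  The dressing `φ ↦ φ^g`, `φ^g(y,μ) = Ad_{g(y+e_μ)} φ(y,μ)` (`NE3CpushGaugeCovariance.vary_gaugeAct`:
`(U e^{sφ})^g = U^g e^{sφ^g} = U e^{sφ^g}`), maps the space `W` of skew `P`-periodic `U`-tangent directions (`TangentIter L k U`, i.e. `D_U φ = 0`) to itself
(`D_U φ^g = Ad(D_U φ) = 0`), preserves the real Hilbert–Schmidt form `Σ_{y ∈ periodBox P} Σ_μ hsR (φ y μ) (ψ y μ)` (`hsR_Ad`), which is positive definite on `W`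
(a periodic field is read on its window), and leaves the first variation `ℓ = dAction U · F` invariant for EVERY plaquette window `F` (the Wilson action is
gauge invariant plaquette by plaquette, `NE3EnergyAssembly.fineAction_gaugeAct`; `dAction` is the derivative of `s ↦ A_F(U e^{sφ})` at `0`,
`NE7ExactCurrent.hasDerivAt_fineAction_vary_dAction`).  `W` is finite-dimensional (restriction to the window `resDir P` is injective on periodic fields), so
`NE7InvariantFunctionalLetter.eq_zero_of_invariant_of_vanish_on_fixed` applies: if `ℓ` vanishes on the `𝒦`-fixed directions it vanishes on `W`.
WHAT ([folklore]; 0 def, 0 sorry; every `d`, every `U(n)`, every `L ≥ 1`).  §1 `dAction_Ad_of_gaugeAct_eq` (invariance of the first variation under the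
stabiliser of `U`, any window), `tangentIter_Ad_of_gaugeAct_eq` (the tangent space is stable under the stabiliser); §2 **`dAction_eq_zero_of_symmetric`**
(symmetric criticality: `𝒦`-invariant tangent-criticality ⇒ tangent-criticality).
HONEST FRAMING (page 1): kinematics + finite-dimensional linear algebra over the tree's B7 transcription; nothing of Bałaban's asserted; no minimiser, no
estimate; NOT NE7, NOT NE3, row NE7b NOT PRINTED ∕ NOT PROVED; spine 0∕9; finite T⁴ rung (B)+1 — NOT infinite volume, NOT mass gap, NOT BetaPertH, NOT Clay
(continuum YM on T⁴ ⇐ BetaPertH ∧ nine spine estimates).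
-/

set_option autoImplicit false

open scoped BigOperators Matrix Matrix.Norms.L2Operator
open Finset

namespace Summit.QuantumFields.BalabanUV.T4Continuum.NE7SymmetricCriticality

open Literature.MathematicalPhysics.QuantumFieldTheory.Balaban1983to89
open B7Prop1Explicit B7Prop2Explicit MatrixNorms
open T4AveragingDeficitWall (IsUnitaryCfg IsSkewDir SmallField Ad vary fineAction)
open T4AveragingDeficitWallBoundary (periodBox)
open AveragingDeficitPeriodicCounting (IsPeriodicDir)
open AveragingDeficitMultiLevelPrep (LevelSmall TangentIter)
open AveragingDeficitTorusChart (TDir resDir extDir extDir_resDir)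
open AveragingDeficitNearIdentity (Ad_add Ad_zero)
open AveragingDeficitTransport (Ad_mem_skewAdjoint)
open NE3HessForm (dAction)
open NE3EnergyShapes (IsUnitarySite IsPeriodicSite)
open NE3EnergyAssembly (fineAction_gaugeAct)
open NE3EnergyHessBilin (Ad_real_smul)
open NE3TangentCovariantTower (dirIter tangentIter_iff_dirIter_eq_zero dirIter_add)
open NE3CpushGaugeCovariance (vary_gaugeAct dirIter_gaugeAct)
open NE3FrameFreeDecompositionLinear (dirIter_zero_dir)
open NE3FrameFreeDecompositionPrep (hsR_smul_left hsR_smul_right)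
open NE3CovariantCalculus (hsR hsR_self hsR_add_left hsR_add_right hsR_Ad)
open NE3LandauOrbit (eq_zero_of_nhsNormSq_eq_zero)
open NE7CombSliceSourceDuality (dirIter_smul)
open NE7ExactCurrent (dAction_add dAction_smul hasDerivAt_fineAction_vary_dAction)
open NE7InvariantFunctionalLetter (apply_eq_zero_of_invariant_of_vanish_on_fixed)

noncomputable section

variable {d : ℕ} {n : Type*} [Fintype n] [DecidableEq n]

/-! ## §1 The stabiliser of `U` acts on the tangent space and fixes the first variation -/

/-- **THE FIRST VARIATION IS INVARIANT UNDER THE STABILISER OF `U`**, for every plaquette window `F`: if `gaugeAct g U = U` then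
`dAction U φ^g F = dAction U φ F`, `φ^g(y,μ) = Ad_{g(y+e_μ)} φ(y,μ)` (`(U e^{sφ})^g = U e^{sφ^g}` and the Wilson action is gauge invariant). [folklore] -/
theorem dAction_Ad_of_gaugeAct_eq (g : Site d → (Matrix n n ℂ)ˣ) {U : Site d → Fin d → (Matrix n n ℂ)ˣ} (hfix : gaugeAct g U = U) (φ : Site d → Fin d → Matrix n n ℂ)
    (F : Finset (T4AveragingDeficitWall.Plaq d)) :
    dAction U (fun y μ => Ad (g (y + e μ)) (φ y μ)) F = dAction U φ F := by
  have h1 : (fun s : ℝ => fineAction (vary U (fun y μ => Ad (g (y + e μ)) (φ y μ)) s) F) = fun s => fineAction (vary U φ s) F := by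
    funext s
    have h2 : vary U (fun y μ => Ad (g (y + e μ)) (φ y μ)) s = gaugeAct g (vary U φ s) := by
      have h := vary_gaugeAct g U φ s
      rwa [hfix] at h
    rw [h2, fineAction_gaugeAct]
  have hd := hasDerivAt_fineAction_vary_dAction U φ F
  rw [← h1] at hd
  exact (hasDerivAt_fineAction_vary_dAction U _ F).unique hd

/-- **THE TANGENT SPACE IS STABLE UNDER THE STABILISER OF `U`** (multi-level small-field class): if `gaugeAct g U = U` with `g` unitary, then
`TangentIter L k U φ → TangentIter L k U φ^g`. [folklore] -/
theorem tangentIter_Ad_of_gaugeAct_eq [Nonempty n] {L : ℕ} (hL : 1 ≤ L) (k : ℕ) {U : Site d → Fin d → (Matrix n n ℂ)ˣ} {x : ℝ} (hUu : IsUnitaryCfg U)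
    (hx : 0 ≤ x) (hs : LevelSmall d L k x) (hUx : SmallField U x) {g : Site d → (Matrix n n ℂ)ˣ} (hg : IsUnitarySite g) (hfix : gaugeAct g U = U)
    {φ : Site d → Fin d → Matrix n n ℂ} (hφ : TangentIter L k U φ) : TangentIter L k U (fun y μ => Ad (g (y + e μ)) (φ y μ)) := by
  rw [tangentIter_iff_dirIter_eq_zero] at hφ ⊢
  have h := dirIter_gaugeAct hL k hUu hx hs hUx hg φ
  rw [hfix] at h
  rw [h, hφ]
  funext z κ
  exact Ad_zero _

/-! ## §2 Symmetric criticality -/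

/-- **PALAIS' SYMMETRIC CRITICALITY FOR THE CONSTRAINED WILSON ACTION.**  `U` unitary with `SmallField U x`, `LevelSmall d L k x` (`L ≥ 1`); `𝒦` a set of unitary
`P`-periodic site fields fixing `U` (`gaugeAct g U = U`); `F` any plaquette window.  IF `dAction U φ F = 0` for every skew `P`-periodic `U`-tangent `φ` that is
`𝒦`-INVARIANT (`φ^g = φ` for all `g ∈ 𝒦`), THEN `dAction U φ F = 0` for EVERY skew `P`-periodic `U`-tangent `φ`. [folklore] -/
theorem dAction_eq_zero_of_symmetric [Nonempty n] {L : ℕ} (hL : 1 ≤ L) (k : ℕ) {P : ℕ} [NeZero P] {U : Site d → Fin d → (Matrix n n ℂ)ˣ} {x : ℝ}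
    (hUu : IsUnitaryCfg U) (hx : 0 ≤ x) (hs : LevelSmall d L k x) (hUx : SmallField U x)
    (𝒦 : Set (Site d → (Matrix n n ℂ)ˣ)) (h𝒦u : ∀ g ∈ 𝒦, IsUnitarySite g) (h𝒦P : ∀ g ∈ 𝒦, IsPeriodicSite g (P : ℤ)) (h𝒦fix : ∀ g ∈ 𝒦, gaugeAct g U = U)
    (F : Finset (T4AveragingDeficitWall.Plaq d))
    (hcrit : ∀ φ : Site d → Fin d → Matrix n n ℂ, IsSkewDir φ → IsPeriodicDir φ (P : ℤ) → TangentIter L k U φ →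
      (∀ g ∈ 𝒦, (fun y μ => Ad (g (y + e μ)) (φ y μ)) = φ) → dAction U φ F = 0)
    {φ : Site d → Fin d → Matrix n n ℂ} (hφs : IsSkewDir φ) (hφP : IsPeriodicDir φ (P : ℤ)) (hφT : TangentIter L k U φ) :
    dAction U φ F = 0 := by
  -- the space `W` of skew periodic tangent directions, as an `ℝ`-submodule
  let Wc : Submodule ℝ (Site d → Fin d → Matrix n n ℂ) :=
    { carrier := {ψ | IsSkewDir ψ ∧ IsPeriodicDir ψ (P : ℤ) ∧ dirIter L (k + 1) U ψ = 0}
      add_mem' := by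
        rintro a b ⟨has, haP, haD⟩ ⟨hbs, hbP, hbD⟩
        refine ⟨fun y μ => (skewAdjoint (Matrix n n ℂ)).add_mem (has y μ) (hbs y μ), fun y κ μ => ?_, ?_⟩
        · simp only [Pi.add_apply, haP y κ μ, hbP y κ μ]
        · have h := dirIter_add hL k hUu hx hs hUx a b
          rw [haD, hbD] at h
          rw [show a + b = fun y μ => a y μ + b y μ from rfl, h]
          funext z κ
          simp only [Pi.zero_apply, add_zero]
      zero_mem' := by
        refine ⟨fun _ _ => (skewAdjoint (Matrix n n ℂ)).zero_mem, fun _ _ _ => rfl, ?_⟩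
        exact dirIter_zero_dir hL k hUu hx hs hUx
      smul_mem' := by
        rintro c a ⟨has, haP, haD⟩
        refine ⟨fun y μ => ?_, fun y κ μ => ?_, ?_⟩
        · simp only [Pi.smul_apply]
          exact skewAdjoint.smul_mem c (has y μ)
        · simp only [Pi.smul_apply, haP y κ μ]
        · rw [dirIter_smul hL k hUu hx hs hUx c a, haD, smul_zero] }
  have hmem : ∀ ψ : Site d → Fin d → Matrix n n ℂ, ψ ∈ Wc ↔ IsSkewDir ψ ∧ IsPeriodicDir ψ (P : ℤ) ∧ dirIter L (k + 1) U ψ = 0 := fun ψ => Iff.rfl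
  -- `W` is finite-dimensional: restriction to the period window is injective
  let res : ↥Wc →ₗ[ℝ] TDir d n P :=
    { toFun := fun a => resDir P (a : Site d → Fin d → Matrix n n ℂ)
      map_add' := fun a b => rfl
      map_smul' := fun c a => rfl }
  have hres : Function.Injective res := by
    intro a b h
    apply Subtype.ext
    have ha := extDir_resDir P ((hmem _).1 a.2).2.1
    have hb := extDir_resDir P ((hmem _).1 b.2).2.1
    rw [← ha, ← hb]
    exact congrArg (extDir P) h
  haveI : FiniteDimensional ℝ ↥Wc := Module.Finite.of_injective res hres
  -- the real Hilbert–Schmidt form over the window, positive definite on `W`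
  let B : ↥Wc →ₗ[ℝ] ↥Wc →ₗ[ℝ] ℝ :=
    LinearMap.mk₂ ℝ (fun a b => ∑ y ∈ periodBox (d := d) P, ∑ μ : Fin d, hsR ((a : Site d → Fin d → Matrix n n ℂ) y μ) ((b : Site d → Fin d → Matrix n n ℂ) y μ))
      (fun a a' b => by
        simp only [Submodule.coe_add, Pi.add_apply, hsR_add_left, sum_add_distrib])
      (fun c a b => by
        simp only [Submodule.coe_smul, Pi.smul_apply, hsR_smul_left, mul_sum, smul_eq_mul])
      (fun a b b' => by
        simp only [Submodule.coe_add, Pi.add_apply, hsR_add_right, sum_add_distrib])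
      (fun c a b => by
        simp only [Submodule.coe_smul, Pi.smul_apply, hsR_smul_right, mul_sum, smul_eq_mul])
  have hB : ∀ a b : ↥Wc, B a b = ∑ y ∈ periodBox (d := d) P, ∑ μ : Fin d, hsR ((a : Site d → Fin d → Matrix n n ℂ) y μ) ((b : Site d → Fin d → Matrix n n ℂ) y μ) :=
    fun a b => rfl
  have hpos : ∀ a : ↥Wc, a ≠ 0 → 0 < B a a := by
    intro a ha
    rw [hB]
    have hnn : ∀ y ∈ periodBox (d := d) P, 0 ≤ ∑ μ : Fin d, hsR ((a : Site d → Fin d → Matrix n n ℂ) y μ) ((a : Site d → Fin d → Matrix n n ℂ) y μ) :=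
      fun y _ => sum_nonneg fun μ _ => by rw [hsR_self]; exact nhsNormSq_nonneg _
    rcases (sum_nonneg hnn).lt_or_eq with hlt | heq
    · exact hlt
    · exfalso
      apply ha
      have hzero : ∀ y ∈ periodBox (d := d) P, ∀ μ : Fin d, (a : Site d → Fin d → Matrix n n ℂ) y μ = 0 := by
        intro y hy μ
        have h1 := (sum_eq_zero_iff_of_nonneg hnn).1 heq.symm y hy
        have h2 := (sum_eq_zero_iff_of_nonneg (fun μ _ => by rw [hsR_self]; exact nhsNormSq_nonneg _)).1 h1 μ (mem_univ _)
        rw [hsR_self] at h2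
        exact eq_zero_of_nhsNormSq_eq_zero h2
      have hres0 : res a = 0 := by
        funext r κ
        exact hzero _ (Finset.mem_image_of_mem _ (Finset.mem_univ r)) κ
      exact hres (by rw [hres0, map_zero])
  -- the dressing by `g ∈ 𝒦` as a linear isometry of `W`
  have hT_mem : ∀ g ∈ 𝒦, ∀ a : ↥Wc, (fun y μ => Ad (g (y + e μ)) ((a : Site d → Fin d → Matrix n n ℂ) y μ)) ∈ Wc := by
    intro g hg a
    obtain ⟨has, haP, haD⟩ := (hmem _).1 a.2
    refine ⟨fun y μ => Ad_mem_skewAdjoint (h𝒦u g hg _) (has y μ), fun y κ μ => ?_, ?_⟩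
    · simp only [add_right_comm y ((P : ℤ) • e κ) (e μ), h𝒦P g hg (y + e μ) κ, haP y κ μ]
    · have h := dirIter_gaugeAct hL k hUu hx hs hUx (h𝒦u g hg) (a : Site d → Fin d → Matrix n n ℂ)
      rw [h𝒦fix g hg] at h
      rw [h, haD]
      funext z κ
      exact Ad_zero _
  let T : ↥𝒦 → ↥Wc →ₗ[ℝ] ↥Wc := fun g =>
    { toFun := fun a => ⟨fun y μ => Ad ((g : Site d → (Matrix n n ℂ)ˣ) (y + e μ)) ((a : Site d → Fin d → Matrix n n ℂ) y μ), hT_mem g g.2 a⟩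
      map_add' := fun a b => by
        apply Subtype.ext
        funext y μ
        simp only [Submodule.coe_add, Pi.add_apply, Ad_add]
      map_smul' := fun c a => by
        apply Subtype.ext
        funext y μ
        simp only [Submodule.coe_smul, Pi.smul_apply, Ad_real_smul, RingHom.id_apply] }
  have hTval : ∀ (g : ↥𝒦) (a : ↥Wc), ((T g a : ↥Wc) : Site d → Fin d → Matrix n n ℂ) = fun y μ => Ad ((g : Site d → (Matrix n n ℂ)ˣ) (y + e μ)) ((a : Site d → Fin d → Matrix n n ℂ) y μ) :=
    fun g a => rfl
  have hiso : ∀ Tg ∈ Set.range T, ∀ a b : ↥Wc, B (Tg a) (Tg b) = B a b := by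
    rintro _ ⟨g, rfl⟩ a b
    rw [hB, hB]
    refine sum_congr rfl fun y _ => sum_congr rfl fun μ _ => ?_
    rw [hTval, hTval]
    exact hsR_Ad (h𝒦u g g.2 _) _ _
  -- the first variation as an invariant functional on `W`
  let ℓ : ↥Wc →ₗ[ℝ] ℝ :=
    { toFun := fun a => dAction U (a : Site d → Fin d → Matrix n n ℂ) F
      map_add' := fun a b => by simp only [Submodule.coe_add, dAction_add]
      map_smul' := fun c a => by simp only [Submodule.coe_smul, dAction_smul, RingHom.id_apply, smul_eq_mul] }
  have hℓ : ∀ a : ↥Wc, ℓ a = dAction U (a : Site d → Fin d → Matrix n n ℂ) F := fun a => rfl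
  have hinv : ∀ Tg ∈ Set.range T, ∀ a : ↥Wc, ℓ (Tg a) = ℓ a := by
    rintro _ ⟨g, rfl⟩ a
    rw [hℓ, hℓ, hTval]
    exact dAction_Ad_of_gaugeAct_eq _ (h𝒦fix g g.2) _ F
  have hfixed : ∀ w : ↥Wc, (∀ Tg ∈ Set.range T, Tg w = w) → ℓ w = 0 := by
    intro w hw
    obtain ⟨hws, hwP, hwD⟩ := (hmem _).1 w.2
    rw [hℓ]
    refine hcrit _ hws hwP ((tangentIter_iff_dirIter_eq_zero L k U _).2 hwD) fun g hg => ?_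
    have h := congrArg (fun a : ↥Wc => (a : Site d → Fin d → Matrix n n ℂ)) (hw (T ⟨g, hg⟩) ⟨⟨g, hg⟩, rfl⟩)
    simpa only [hTval] using h
  -- symmetric criticality
  have hφW : φ ∈ Wc := (hmem φ).2 ⟨hφs, hφP, (tangentIter_iff_dirIter_eq_zero L k U φ).1 hφT⟩
  have h := apply_eq_zero_of_invariant_of_vanish_on_fixed B hpos (Set.range T) hiso ℓ hinv hfixed ⟨φ, hφW⟩
  rwa [hℓ] at h

end

end Summit.QuantumFields.BalabanUV.T4Continuum.NE7SymmetricCriticality
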